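import Literature.AlgebraicGeometry.Resolution.HasseSchmidtLocalCriterion
import Mathlib.Algebra.Order.Antidiag.Finsupp
import HarnessLib

/-!
# Taylor's formula to order `N` from a Hasse–Schmidt homomorphism with adapted generators:
# `h ≡ Σ_{|β| = N} D^{[β]}(h) · u^β (mod 𝔪^{N+1})` for `h ∈ 𝔪^N`

Topic: `Literature/AlgebraicGeometry/Resolution`. Setting of `HasseSchmidtLocalCriterion.lean`: a LOCAL commutative
ring `O` with maximal ideal `𝔪` and residue field `κ`, a ring homomorphism `T : O → O⟦t_σ⟧` (`σ` finite) with
`constantCoeff ∘ T = id` (components `D^{[β]} = hsComponent T β`), and generators `u_i` of `𝔪` ADAPTED to `T` to first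
order: `D^{[e_j]} u_i ≡ δ_ij (mod 𝔪)`. No regularity and no characteristic hypothesis. PROVED:

* `residue_hsComponent_prod_pow` — `D^{[γ]}(u^β) ≡ [γ = β] (mod 𝔪)` for `|γ| ≤ |β|` (Leibniz rule, induction on `|β|`);
* `residue_hsComponent_mul_prod_pow` — `D^{[γ]}(c · u^β) ≡ [γ = β] · c (mod 𝔪)` for `|γ| ≤ |β|`;
* `sub_sum_hsComponent_mul_prod_pow_mem_pow_succ` — **Taylor's formula to order `N`**: for `h ∈ 𝔪^N`,
  `h − Σ_{|β| = N} D^{[β]}(h) · u^β ∈ 𝔪^{N+1}`: the initial form of `h` in `gr^N_𝔪(O)` is `Σ_{|β|=N} (D^{[β]}h)‾ · ū^β`,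
  i.e. THE TAYLOR COEFFICIENTS OF ORDER `N` AT THE POINT ARE THE RESIDUES OF THE HASSE–SCHMIDT COMPONENTS;
* `residue_hsComponent_eq_of_sub_sum_mem_pow_succ` — uniqueness: if `h − Σ_{|β| = N} c_β u^β ∈ 𝔪^{N+1}` then
  `(D^{[γ]} h)‾ = c̄_γ` for `|γ| = N`; in particular (`c = 0`) the monomials `ū^β`, `|β| = N`, are `κ`-linearly
  independent in `𝔪^N/𝔪^{N+1}` (adapted Hasse–Schmidt data force `gr_𝔪(O) ≅ κ[t_σ]` degreewise);
* bookkeeping (private `mem_finsuppAntidiag_univ_iff`; for consumers: Mathlib `Finset.mem_finsuppAntidiag` with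
  `Finsupp.degree_eq_sum`): `β ∈ univ.finsuppAntidiag N ↔ |β| = N` — the sums `Σ_{|β| = N}` below run over
  `(Finset.univ : Finset σ).finsuppAntidiag N`.

Proof of Taylor's formula: the remainder `r` lies in `𝔪^N`, and EVERY component `D^{[γ]} r` with `|γ| ≤ N` lies in `𝔪`
(for `|γ| < N` because `D^{[γ]}(𝔪^N) ⊆ 𝔪^{N−|γ|}`; for `|γ| = N` because `D^{[γ]}(D^{[β]}h · u^β) ≡ [γ = β] D^{[β]} h`),
so `r ∈ 𝔪^{N+1}` by the order criterion `mem_maximalIdeal_pow_succ_of_hsComponent_mem`.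

With ONE global Hasse–Schmidt homomorphism of an étale chart (`HasseSchmidtChartOrder.lean`: adapted generators exist
at EVERY closed point for its localisation) this says that the Taylor expansion of a section at every closed point of
the chart is read off the SAME global sections `D^{[β]} h` — the «chart-uniform Hasse–Taylor» asked for by the
campaign `res-hironaka` (GAP-LEDGER R20, lead route README §2; nothing of that manuscript is asserted here).

Sources: [Matsumura1987] §27 (higher derivations; Taylor development `E_t`); [EGAIV4] Thm. 16.11.2 ((16.11.2.2):
`D_q(x^β) = (β over q) x^{β−q}`, Taylor formula along a formally étale coordinate system); [VillamayorU2008ReesDiff]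
§4.1, Remark 4.3.
-/

noncomputable section

namespace Literature.AlgebraicGeometry.Resolution

open Finsupp IsLocalRing MvPowerSeries

universe v

/-! ## Bookkeeping on multi-indices -/

section Indices

variable {σ : Type*}

/-- Two multi-indices with `β ≤ γ` and `|γ| ≤ |β|` are equal. [folklore] -/
private theorem eq_of_le_of_degree_le'' {β γ : σ →₀ ℕ} (hle : β ≤ γ) (hdeg : degree γ ≤ degree β) : β = γ := by
  obtain ⟨c, rfl⟩ := exists_add_of_le hle
  have hc : degree c = 0 := by
    rw [map_add] at hdeg
    omega
  rw [degree_eq_zero_iff] at hc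
  rw [hc, add_zero]

/-- A multi-index of degree `1` is a unit vector. [folklore] -/
private theorem exists_eq_single_of_degree_eq_one' {β : σ →₀ ℕ} (h : degree β = 1) : ∃ j, β = single j 1 := by
  have hne : β ≠ 0 := fun h0 => by rw [h0, map_zero] at h; exact zero_ne_one h
  obtain ⟨j, hj⟩ := Finsupp.support_nonempty_iff.mpr hne
  refine ⟨j, ?_⟩
  have hle : single j 1 ≤ β :=
    Finsupp.single_le_iff.mpr (Nat.one_le_iff_ne_zero.mpr (Finsupp.mem_support_iff.mp hj))
  exact (eq_of_le_of_degree_le'' hle (by rw [degree_single, h])).symm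

/-- `β ∈ univ.finsuppAntidiag N ↔ |β| = N` (the finite set of multi-indices of degree `N` over a finite index type;
consumers: `Finset.mem_finsuppAntidiag` + `Finsupp.degree_eq_sum`). [folklore] -/
private theorem mem_finsuppAntidiag_univ_iff [Fintype σ] [DecidableEq σ] (N : ℕ) (β : σ →₀ ℕ) :
    β ∈ (Finset.univ : Finset σ).finsuppAntidiag N ↔ degree β = N := by
  rw [Finset.mem_finsuppAntidiag, degree_eq_sum]
  simp

end Indices

/-! ## Components of monomials in adapted generators -/

section Local

variable {O : Type v} [CommRing O] [IsLocalRing O] {σ : Type*} [Fintype σ] [DecidableEq σ]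
  (T : O →+* MvPowerSeries σ O)

omit [IsLocalRing O] [Fintype σ] [DecidableEq σ] in
/-- Components are compatible with subtraction. [folklore] -/
private theorem hsComponent_sub'' (β : σ →₀ ℕ) (a b : O) :
    hsComponent T β (a - b) = hsComponent T β a - hsComponent T β b := by
  simp [hsComponent]

omit [IsLocalRing O] [Fintype σ] [DecidableEq σ] in
/-- Components are compatible with finite sums. [folklore] -/
private theorem hsComponent_finset_sum {ι : Type*} (β : σ →₀ ℕ) (s : Finset ι) (f : ι → O) :
    hsComponent T β (∑ i ∈ s, f i) = ∑ i ∈ s, hsComponent T β (f i) := by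
  simp only [hsComponent, map_sum]

omit [Fintype σ] in
/-- First-order adaptation in the residue field: `(D^{[e_j]} u_i)‾ = δ_ij`. [folklore] -/
private theorem residue_hsComponent_single_adapted' {u : σ → O}
    (hlin : ∀ i j, hsComponent T (single j 1) (u i) - (if i = j then 1 else 0) ∈ maximalIdeal O) (i j : σ) :
    residue O (hsComponent T (single j 1) (u i)) = if i = j then 1 else 0 := by
  have := hlin i j
  rw [← residue_eq_zero_iff, map_sub, sub_eq_zero] at this
  rw [this]
  split_ifs <;> simp

/-- **`D^{[γ]}(u^β) ≡ [γ = β] (mod 𝔪)` for `|γ| ≤ |β|`**, for generators `u_i ∈ 𝔪` adapted to the Hasse–Schmidt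
homomorphism `T` to first order. Induction on `|β|`, peeling off one factor `u_i` with the Leibniz rule
`D^{[γ]}(P u_i) = Σ_{γ₁+γ₂=γ} D^{[γ₁]}P · D^{[γ₂]}u_i`: the term `γ₂ = 0` dies because `u_i ∈ 𝔪`, the terms `γ₂ = e_j`
contribute `[γ₁ = β′] δ_ij`, and `|γ₂| ≥ 2` forces `|γ₁| < |β′|`, killed by the induction hypothesis.
[cite: EGAIV4, Thm. 16.11.2 ((16.11.2.2): `D_q(x^β) = (β over q) x^{β − q}`)] [cite: Matsumura1987, §27] -/
theorem residue_hsComponent_prod_pow (hT0 : ∀ b, constantCoeff (T b) = b) {u : σ → O}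
    (hu : Ideal.span (Set.range u) = maximalIdeal O)
    (hlin : ∀ i j, hsComponent T (single j 1) (u i) - (if i = j then 1 else 0) ∈ maximalIdeal O) :
    ∀ (n : ℕ) (β : σ →₀ ℕ), degree β = n → ∀ γ : σ →₀ ℕ, degree γ ≤ n →
      residue O (hsComponent T γ (∏ i, u i ^ β i)) = if γ = β then 1 else 0
  | 0, β, hn, γ, hγ => by
    have hβ : β = 0 := (degree_eq_zero_iff β).mp hn
    have hγ0 : γ = 0 := (degree_eq_zero_iff γ).mp (Nat.le_zero.mp hγ)
    subst hβ hγ0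
    simp [hsComponent_zero T hT0]
  | n + 1, β, hn, γ, hγ => by
    have hu𝔪 : ∀ i, u i ∈ maximalIdeal O := fun i => hu ▸ Ideal.subset_span ⟨i, rfl⟩
    -- split off one variable: `β = β' + e_i`
    obtain ⟨i, hi⟩ : ∃ i, β i ≠ 0 := by
      by_contra h
      push Not at h
      have : β = 0 := Finsupp.ext h
      rw [this, map_zero] at hn
      exact Nat.succ_ne_zero n hn.symm
    have hile : single i 1 ≤ β := Finsupp.single_le_iff.mpr (Nat.one_le_iff_ne_zero.mpr hi)
    obtain ⟨β', hβeq⟩ := exists_add_of_le hile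
    have hdeg' : degree β' = n := by
      have := congrArg degree hβeq
      rw [map_add, degree_single, hn] at this
      omega
    have hprod : (∏ l, u l ^ β l) = (∏ l, u l ^ β' l) * u i := by
      rw [hβeq]
      simp only [Finsupp.add_apply, pow_add, Finset.prod_mul_distrib]
      rw [mul_comm]
      congr 1
      rw [Finset.prod_eq_single i (fun l _ hl => by rw [single_eq_of_ne hl, pow_zero])
        (fun h => absurd (Finset.mem_univ i) h), single_eq_same, pow_one]
    rw [hprod, hsComponent_mul, map_sum]
    have hterm : ∀ q ∈ Finset.antidiagonal γ,
        residue O (hsComponent T q.1 (∏ l, u l ^ β' l) * hsComponent T q.2 (u i)) =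
          if q = (β', single i 1) then 1 else 0 := by
      intro q hq
      rw [Finset.mem_antidiagonal] at hq
      have hdegγ : degree q.1 + degree q.2 = degree γ := by rw [← map_add, hq]
      rw [map_mul]
      by_cases h2 : q.2 = 0
      · rw [h2, hsComponent_zero T hT0, (residue_eq_zero_iff _).mpr (hu𝔪 i), mul_zero, if_neg]
        intro h
        rw [h] at h2
        simp at h2
      by_cases h2' : degree q.2 = 1
      · obtain ⟨j, hj⟩ := exists_eq_single_of_degree_eq_one' h2'
        rw [hj, residue_hsComponent_single_adapted' T hlin]
        by_cases hij : i = j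
        · subst hij
          rw [if_pos rfl, mul_one]
          have hdeg1 : degree q.1 ≤ n := by rw [hj, degree_single] at hdegγ; omega
          rw [residue_hsComponent_prod_pow hT0 hu hlin n β' hdeg' q.1 hdeg1]
          by_cases hq1 : q.1 = β'
          · rw [if_pos hq1, if_pos (Prod.ext hq1 hj)]
          · rw [if_neg hq1, if_neg (fun h => hq1 (congrArg Prod.fst h))]
        · rw [if_neg hij, mul_zero, if_neg]
          intro h
          apply hij
          have := congrArg Prod.snd h
          rw [hj] at this
          exact ((Finsupp.single_left_inj one_ne_zero).mp this).symm
      · have h2ge : 2 ≤ degree q.2 := by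
          have : degree q.2 ≠ 0 := fun h => h2 ((degree_eq_zero_iff _).mp h)
          omega
        have hlt : degree q.1 < n := by omega
        rw [residue_hsComponent_prod_pow hT0 hu hlin n β' hdeg' q.1 hlt.le, if_neg, zero_mul, if_neg]
        · intro h
          have := congrArg Prod.snd h
          rw [this, degree_single] at h2'
          exact h2' rfl
        · intro h
          rw [h, hdeg'] at hlt
          exact lt_irrefl _ hlt
    rw [Finset.sum_congr rfl hterm, Finset.sum_ite_eq']
    by_cases hγβ : γ = β
    · rw [if_pos hγβ, if_pos]
      rw [Finset.mem_antidiagonal, hγβ, hβeq, add_comm]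
    · rw [if_neg hγβ, if_neg]
      intro h
      rw [Finset.mem_antidiagonal] at h
      apply hγβ
      rw [← h, hβeq, add_comm]

/-- **`D^{[γ]}(c · u^β) ≡ [γ = β] · c (mod 𝔪)` for `|γ| ≤ |β|`** and any `c ∈ O` (Leibniz rule and
`residue_hsComponent_prod_pow`; only the term `D^{[0]}c · D^{[γ]}(u^β)` survives). [cite: EGAIV4, Thm. 16.11.2]
[cite: Matsumura1987, §27] -/
theorem residue_hsComponent_mul_prod_pow (hT0 : ∀ b, constantCoeff (T b) = b) {u : σ → O}
    (hu : Ideal.span (Set.range u) = maximalIdeal O)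
    (hlin : ∀ i j, hsComponent T (single j 1) (u i) - (if i = j then 1 else 0) ∈ maximalIdeal O) (c : O)
    {β γ : σ →₀ ℕ} (hγ : degree γ ≤ degree β) :
    residue O (hsComponent T γ (c * ∏ i, u i ^ β i)) = if γ = β then residue O c else 0 := by
  rw [hsComponent_mul, map_sum]
  have hterm : ∀ q ∈ Finset.antidiagonal γ,
      residue O (hsComponent T q.1 c * hsComponent T q.2 (∏ i, u i ^ β i)) =
        if q = (0, β) then residue O c else 0 := by
    intro q hq
    rw [Finset.mem_antidiagonal] at hq
    have hq2le : q.2 ≤ γ := by rw [← hq]; exact le_add_self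
    have hdeg2 : degree q.2 ≤ degree β := by
      have : degree q.1 + degree q.2 = degree γ := by rw [← map_add, hq]
      omega
    rw [map_mul, residue_hsComponent_prod_pow T hT0 hu hlin (degree β) β rfl q.2 hdeg2]
    by_cases h2 : q.2 = β
    · -- then `q.2 = γ` and `q.1 = 0`
      have hγ2 : q.2 = γ := eq_of_le_of_degree_le'' hq2le (by rw [h2]; exact hγ)
      have h10 : q.1 = 0 := by
        have := hq
        rw [hγ2] at this
        simpa using this
      rw [if_pos h2, mul_one, if_pos (Prod.ext h10 h2), h10, hsComponent_zero T hT0]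
    · rw [if_neg h2, mul_zero, if_neg (fun h => h2 (congrArg Prod.snd h))]
  rw [Finset.sum_congr rfl hterm, Finset.sum_ite_eq']
  by_cases hγβ : γ = β
  · rw [if_pos hγβ, if_pos]
    rw [Finset.mem_antidiagonal, zero_add, hγβ]
  · rw [if_neg hγβ, if_neg]
    intro h
    rw [Finset.mem_antidiagonal, zero_add] at h
    exact hγβ h.symm

/-! ## Taylor's formula to order `N` -/

omit [IsLocalRing O] in
/-- A product `∏ u_i^{d_i}` of elements of an ideal `I` lies in `I^{|d|}`. [folklore] -/
private theorem prod_pow_mem_pow' {I : Ideal O} {u : σ → O} (hu : ∀ i, u i ∈ I) (d : σ →₀ ℕ) :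
    (∏ i, u i ^ d i) ∈ I ^ degree d := by
  rw [degree_eq_sum]
  induction (Finset.univ : Finset σ) using Finset.induction_on with
  | empty => simp
  | insert a s ha ih =>
    rw [Finset.prod_insert ha, Finset.sum_insert ha, pow_add]
    exact Ideal.mul_mem_mul (Ideal.pow_mem_pow (hu a) _) ih

/-- **Taylor's formula to order `N` (Hasse–Schmidt form).** `O` local, `T` a Hasse–Schmidt homomorphism
(`constantCoeff ∘ T = id`), `u_i` generators of `𝔪` adapted to `T` to first order. For `h ∈ 𝔪^N`:
`h − Σ_{|β| = N} D^{[β]}(h) · u^β ∈ 𝔪^{N+1}` (sum over `univ.finsuppAntidiag N`). Equivalently the initial form of `h`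
in `𝔪^N/𝔪^{N+1}` is `Σ_{|β| = N} (D^{[β]} h)‾ ū^β`. [cite: Matsumura1987, §27 (Taylor development `E_t`)]
[cite: EGAIV4, Thm. 16.11.2 (Taylor formula along a formally étale coordinate system)]
[cite: VillamayorU2008ReesDiff, §4.1 and Remark 4.3] -/
theorem sub_sum_hsComponent_mul_prod_pow_mem_pow_succ (hT0 : ∀ b, constantCoeff (T b) = b) {u : σ → O}
    (hu : Ideal.span (Set.range u) = maximalIdeal O)
    (hlin : ∀ i j, hsComponent T (single j 1) (u i) - (if i = j then 1 else 0) ∈ maximalIdeal O)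
    {N : ℕ} {h : O} (hh : h ∈ maximalIdeal O ^ N) :
    h - ∑ β ∈ (Finset.univ : Finset σ).finsuppAntidiag N, hsComponent T β h * ∏ i, u i ^ β i ∈
      maximalIdeal O ^ (N + 1) := by
  have hu𝔪 : ∀ i, u i ∈ maximalIdeal O := fun i => hu ▸ Ideal.subset_span ⟨i, rfl⟩
  set r := h - ∑ β ∈ (Finset.univ : Finset σ).finsuppAntidiag N, hsComponent T β h * ∏ i, u i ^ β i with hr_def
  refine mem_maximalIdeal_pow_succ_of_hsComponent_mem T hT0 hu hlin N r fun γ hγ => ?_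
  rw [← residue_eq_zero_iff, hr_def, hsComponent_sub'', hsComponent_finset_sum, map_sub, map_sum]
  have hterm : ∀ β ∈ (Finset.univ : Finset σ).finsuppAntidiag N,
      residue O (hsComponent T γ (hsComponent T β h * ∏ i, u i ^ β i)) =
        if γ = β then residue O (hsComponent T β h) else 0 := by
    intro β hβ
    rw [mem_finsuppAntidiag_univ_iff] at hβ
    exact residue_hsComponent_mul_prod_pow T hT0 hu hlin _ (by rw [hβ]; exact hγ)
  rw [Finset.sum_congr rfl hterm, Finset.sum_ite_eq]
  rcases hγ.lt_or_eq with hlt | heq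
  · -- `|γ| < N`: `γ` is not a summation index, and `D^{[γ]} h ∈ 𝔪` because `h ∈ 𝔪^N`
    rw [if_neg (by rw [mem_finsuppAntidiag_univ_iff]; omega), sub_zero, residue_eq_zero_iff]
    exact Ideal.pow_le_self (by omega) (hsComponent_mem_pow T hT0 (maximalIdeal O) N γ hh)
  · rw [if_pos (by rw [mem_finsuppAntidiag_univ_iff]; exact heq), sub_self]

/-- **Uniqueness of the Taylor coefficients.** If `h − Σ_{|β| = N} c_β u^β ∈ 𝔪^{N+1}` for some coefficients `c_β ∈ O`,
then `(D^{[γ]} h)‾ = c̄_γ` in the residue field for every `|γ| = N`. [cite: Matsumura1987, §27]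
[cite: EGAIV4, Thm. 16.11.2] -/
theorem residue_hsComponent_eq_of_sub_sum_mem_pow_succ (hT0 : ∀ b, constantCoeff (T b) = b) {u : σ → O}
    (hu : Ideal.span (Set.range u) = maximalIdeal O)
    (hlin : ∀ i j, hsComponent T (single j 1) (u i) - (if i = j then 1 else 0) ∈ maximalIdeal O)
    {N : ℕ} {h : O} (c : (σ →₀ ℕ) → O)
    (hc : h - ∑ β ∈ (Finset.univ : Finset σ).finsuppAntidiag N, c β * ∏ i, u i ^ β i ∈
      maximalIdeal O ^ (N + 1))
    {γ : σ →₀ ℕ} (hγ : degree γ = N) :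
    residue O (hsComponent T γ h) = residue O (c γ) := by
  have h1 := hsComponent_mem_pow T hT0 (maximalIdeal O) (N + 1) γ hc
  rw [hγ, show N + 1 - N = 1 by omega, pow_one, ← residue_eq_zero_iff, hsComponent_sub'', hsComponent_finset_sum,
    map_sub, map_sum] at h1
  have hterm : ∀ β ∈ (Finset.univ : Finset σ).finsuppAntidiag N,
      residue O (hsComponent T γ (c β * ∏ i, u i ^ β i)) = if γ = β then residue O (c β) else 0 := by
    intro β hβ
    rw [mem_finsuppAntidiag_univ_iff] at hβ
    exact residue_hsComponent_mul_prod_pow T hT0 hu hlin (c β) (by rw [hβ, hγ])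
  rw [Finset.sum_congr rfl hterm, Finset.sum_ite_eq,
    if_pos (show γ ∈ (Finset.univ : Finset σ).finsuppAntidiag N by rw [mem_finsuppAntidiag_univ_iff]; exact hγ),
    sub_eq_zero] at h1
  exact h1

/-- **The monomials `ū^β`, `|β| = N`, are linearly independent in `𝔪^N/𝔪^{N+1}`**: if `Σ_{|β| = N} c_β u^β ∈ 𝔪^{N+1}`
then every `c_γ ∈ 𝔪` (`|γ| = N`). With Taylor's formula: adapted Hasse–Schmidt data force
`gr^N_𝔪(O) = ⊕_{|β| = N} κ ū^β`. [cite: Matsumura1987, §27] [cite: EGAIV4, Thm. 16.11.2 and Prop. 17.12.4 (formal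
smoothness and the symmetric algebra of `𝔪/𝔪²`)] -/
theorem mem_maximalIdeal_of_sum_mul_prod_pow_mem_pow_succ (hT0 : ∀ b, constantCoeff (T b) = b) {u : σ → O}
    (hu : Ideal.span (Set.range u) = maximalIdeal O)
    (hlin : ∀ i j, hsComponent T (single j 1) (u i) - (if i = j then 1 else 0) ∈ maximalIdeal O)
    {N : ℕ} (c : (σ →₀ ℕ) → O)
    (hc : ∑ β ∈ (Finset.univ : Finset σ).finsuppAntidiag N, c β * ∏ i, u i ^ β i ∈ maximalIdeal O ^ (N + 1))
    {γ : σ →₀ ℕ} (hγ : degree γ = N) : c γ ∈ maximalIdeal O := by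
  have h0 := residue_hsComponent_eq_of_sub_sum_mem_pow_succ T hT0 hu hlin (h := 0) c
    (by rw [zero_sub]; exact neg_mem hc) hγ
  rw [show hsComponent T γ (0 : O) = 0 by simp [hsComponent], map_zero] at h0
  exact (residue_eq_zero_iff _).mp h0.symm

end Local

end Literature.AlgebraicGeometry.Resolution

end
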